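import Literature.Probability.Percolation.Isoradial
import Literature.Probability.Percolation.IsoradialArmUniversality
import Literature.Probability.LatticeModels.IsoradialPercolationProofs
import HarnessLib

/-!
# The alternating arm events of Grimmett–Manolescu: the case `j = 1`

Proofs-only companion of `Literature.Probability.Percolation.IsoradialArmUniversality`, which
vendors the cluster-separated alternating `2j`-arm event `RhombicEmbedding.embAltArmEvent` of
Grimmett–Manolescu, *Bond percolation on isoradial graphs: criticality and universality*,
PTRF 159 (2014) 273–327 = arXiv:1204.0505, §3 / §8.2 — the event of the named fact
`gm_universality_arms` of `Isoradial.lean` (§3, Theorem "Universality" (a), `π = ρ_{2j}`) since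
its restatement in place (2026-08-15; the original transcription used the prelude's
`embArmEvent (alternatingColours j)`, which for `j ≥ 2` drops the cyclic alternation of the arms,
and the weak H21 square-grid property; records in the module docstrings of
`IsoradialArmUniversality` and `Isoradial`).

This file proves that **for `2j = 2` arms the two renderings agree**:
`RhombicEmbedding.embArmEvent_alternatingColours_one` — for one primal and one dual arm no
order or separation condition arises, so the prelude's event `embArmEvent (alternatingColours 1) r R`
*equals* `embAltArmEvent 1 r R` (the event `A_2(N, n)` of the source; §8.2, `k = 2`:
"`x_1 ↔ y_1` and `x_1^* ↔^* y_1^*`"). Consequently the `j = 1` case (`π = ρ_2`) of the original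
transcription and of the restated fact coincide up to the square-grid hypothesis (the old body
implying the new one there, through `HasSquareGridPropertyGM.hasSquareGridProperty`); the
sibling file `IsoradialPrintedArms` has the same identity read from the other side
(`RhombicEmbedding.embAltArmEvent_one_eq`) together with the `ℤ²` witness showing that for
`j = 2` the prelude's event is strictly larger (`embAltArmEvent_two_ssubset_embArmEvent`).
(Until 2026-08-15 this file also carried `gm_universality_arms.toAltArms_one`, deriving the
`j = 1` case of the corrected statement from the original body taken as hypothesis
`(h : gm_universality_arms G emb ε)`; it was removed, with its twins in `IsoradialPrintedArms`,
when that body was superseded.)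

Everything here is proved; no definition, no named fact.

## References

* G. R. Grimmett, I. Manolescu, *Bond percolation on isoradial graphs: criticality and
  universality*, PTRF 159 (2014) 273–327, arXiv:1204.0505: §3 (arm events `A_σ(N, n)`,
  `A_{2j}`; Theorem (Universality) (a)), §8.2 (modified arm events `Ã_k`).
-/

noncomputable section

open MeasureTheory

namespace Literature.Probability.Percolation

open LatticeModels Percolation

section JOne

variable {V : Type*} {G : SimpleGraph V} {F : Type*} (emb : RhombicEmbedding G F)

/-- **For `2j = 2` arms the two renderings agree.** The H21 arm event with colour sequence
(open, dual) — one primal open crossing and one dual-open crossing of `Λ_R ∖ Λ_r`, slack `2` —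
equals the cluster-separated alternating event `embAltArmEvent 1 r R`: the separation clauses
of the latter are vacuous over `Fin 1`, and crossings given by walks supported in the annulus
are exactly connections inside `annulusPts` (`mem_openConnIn_iff_exists_openWalk`,
`dualConnIn_iff_exists_walk`). This is the event `A_2(N, n)` of the source ("`x_1 ↔ y_1` and
`x_1^* ↔^* y_1^*`", §8.2, `k = 2`). (Grimmett–Manolescu 2014, §3, `A_{2j}` with `j = 1`;
§8.2.) [cite: GrimmettManolescu2014Isoradial, §3 (A_2) and §8.2 (Ã_2: x_1 ↔ y_1, x_1* ↔* y_1*)] -/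
theorem _root_.Literature.Probability.LatticeModels.RhombicEmbedding.embArmEvent_alternatingColours_one
    (r R : ℕ) : emb.embArmEvent (alternatingColours 1) r R = emb.embAltArmEvent 1 r R := by
  refine Set.Subset.antisymm ?_ (emb.embAltArmEvent_subset_embArmEvent 1 r R)
  rintro ω ⟨x, y, w, f, g, w', hP, hD, -, -⟩
  have h0 : alternatingColours 1 ⟨0, by norm_num⟩ = true := by decide
  have h1 : alternatingColours 1 ⟨1, by norm_num⟩ = false := by decide
  obtain ⟨hx, hy, hw⟩ := hP _ h0
  obtain ⟨hf, hg, hw'⟩ := hD _ h1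
  refine ⟨⟨fun _ => x ⟨0, by norm_num⟩, fun _ => y ⟨0, by norm_num⟩, fun _ => ⟨hx, hy, ?_⟩, ?_⟩,
    ⟨fun _ => f ⟨1, by norm_num⟩, fun _ => g ⟨1, by norm_num⟩, fun _ => ⟨hf, hg, ?_⟩, ?_⟩⟩
  · exact mem_openConnIn_iff_exists_openWalk.2 ⟨w _, fun v hv => hw v hv⟩
  · intro i i' hii'
    exact absurd (Subsingleton.elim i i') hii'
  · exact (emb.dualConnIn_iff_exists_walk ω _ _ _).2 ⟨w' _, fun v hv => hw' v hv⟩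
  · intro i i' hii'
    exact absurd (Subsingleton.elim i i') hii'

end JOne

end Literature.Probability.Percolation
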